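/-
Copyright (c) 2026 the pub-hodgecm-mathlib formalisation cell (harness21).  Prover seat hodgecm-mathlib-K2-defs1 (g6), Track B DEFS FILER, h413 = `stmt-HodgeConjecture-24833`,
route `HCCMUnconditional`, campaign «5Res CRITICAL PATH», deal (65) of dealer K2E1-plan (g6) 2026-09-04T10:22:41Z «(χ,τ)-CURRENCY DEFS LEAF» (census K2E4-p23 (g2) 10:16:55Z (3)(a);
REPORT-FIRST `K2/K2-defs1/g6/REPORT-65-chi-currency.K2-defs1-g6.md` 10:26Z).
-/
import Summits.HodgeConjecture.HodgeConjecture.Theorems.K2E1BorelEisensteinUDefs      -- ★ `flatSectionU`, `eisensteinSeriesU`, `toAdelic_mem_borelAdelic_of_mem_borelU`; brings ★ `borelHeight_borel_mul`, `lastEntryUnit`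
import Literature.NumberTheory.GaloisRepresentations.HeckeCharacter                    -- ★ `HeckeCharacter`, `ideleGroup`, `principalIdeles`, `map_principal`, `IsUnitary`
import Literature.NumberTheory.Automorphic.UnitaryGroupOfFormAdelicTopology            -- ★ `continuous_conjAdele`
import HarnessLib

/-!
# The `(χ, τ)`-currency of the Borel Eisenstein series of `U(J_N)`: `χ`-equivariant sections `φ(b g) = χ(b₀₀) φ(g)`, the reflected character `χʷ(a) = χ(c a)⁻¹`,
# and the statement-only shape of the intertwined constant term — DEFINITIONS (+ trivial API)

Cell `pub/hodgecm-mathlib`, crux H413 = `stmt-HodgeConjecture-24833`.  DEFINITIONS FILE (`--kind definition`, review-queued); no `instance`, no notation, no named-fact hypothesis,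
no `sorry`.  Generic `F E c N` (`[NeZero N]`); the deal is the `U(1,1)` leaf (`N = 2`, Levi `T(𝔸) = {diag(a, ā⁻¹)} ≅ 𝔸_Lˣ`), and only §4 (`1 − z`) is `N = 2`-specific.

THE CURRENCY ([MoeglinWaldspurger1995, I.2.17, II.1.5]; [GelbartRogawski1991, §3.1]; [Tan1999, §1]).  A Hecke character is the tree's ★ `HeckeCharacter E` (continuous `𝕀_E = 𝔸_Eˣ →* ℂˣ`
trivial on `Eˣ`; NOT re-declared).  For `b ∈ B(𝔸_F)` (upper triangular in `U(J_N)(𝔸_F) ≤ GL_N(𝔸_E)`) the first diagonal entry `b₀₀` is an idele (§1 `firstEntryUnit`, the twin of ★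
`lastEntryUnit = b_{N−1,N−1}`; for `N = 2`, `b = (a *; 0 ā⁻¹)` and `b₀₀ = a`).  A function `φ : G(𝔸) → ℂ` is a **`χ`-SECTION** (§2 `IsChiSection χ φ`) when `φ(b g) = χ(b₀₀)·φ(g)` for all
`b ∈ B(𝔸_F)`; then the ★ flat section `flatSectionU φ z = φ·H^z` satisfies `f_z(b g) = χ(b₀₀)·‖b_{N−1,N−1}‖_𝔸^{−z}·f_z(g)` (★ `borelHeight_borel_mul`; for `N = 2`, `‖ā⁻¹‖⁻¹ = ‖a‖`, so
`f_z ∈ I(χ‖·‖^z) = ` K2Liu's `I(s, χ)` at `z = s + ½`, ★ `K2E1BorelEisensteinU2FromK2Liu.detDelta_bridge`), is left-`N(𝔸)`- and left-`B(F)`-invariant (`χ(Eˣ) = 1` + product formula), and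
its Eisenstein series is ★ `eisensteinSeriesU (flatSectionU φ z)` VERBATIM — no `flatSectionChi`, no `eisensteinSeriesChi` (they would be synonyms).  The torus coordinate `a(g)` on all of
`G(𝔸)` is deliberately NOT introduced (ill-defined on `T(𝔸) ∩ K` for ramified `χ`).  §3 is the REFLECTED CHARACTER `χʷ := (χ ∘ (c ⊗ 1))⁻¹` (`w·diag(a, ā⁻¹)·w⁻¹ = diag(ā⁻¹, a)`), again a
★ `HeckeCharacter E`; §4 the statement-only SHAPE «`M(z, χ)φ = φ′ ∈ I(χʷ)`» of the intertwining integral, so that the ★ Bruhat unfolding `borelConstantTerm_eisensteinSeriesU_two` (which needs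
only measurability and `N(𝔸)`∕`B(F)`-invariance, hence applies to `χ`-sections verbatim) reads `E_B(f_z) = f_z + (ν𝓕)⁻¹ • f′_{1−z}` — the target of the (χ,τ) FILE A2; nothing is proved about it here.
-- TODO(general form): for `N ≥ 3` the cuspidal data on the Borel Levi are characters of the full `T(𝔸)∕T(F)` (`U(2,1)`: `(χ₁(α), χ₂(β))` on `d(α, β, ᾱ⁻¹)`); `IsChiSection` is the `χ₂ = 1` slice.

* §1 `firstEntryUnit` (+ `coe_`, `_mul`, `_one`, `_eq_one_of_mem_adelicUnipotent`, `_toAdelic_mem_principalIdeles`).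
* §2 `IsChiSection` (+ `.borel_mul`, `.unipotent_mul`, `.toAdelic_mul`, `.zero ∕ .add ∕ .smul ∕ .mul_of_invariant`, `norm_apply_borel_mul_of_isUnitary`, `flatSectionU_borel_mul_of_isChiSection`,
  `flatSectionU_toAdelic_mul_of_isChiSection`, `isChiSection_one_iff`-direction `isChiSection_of_borel_invariant` for `χ = 1`).
* §3 `reflectChar c χ` (+ `coe_reflectChar_apply`, `reflectChar_reflectChar`, `IsUnitary.reflectChar`).
* §4 (`N = 2`) `HasReflectedIntertwining χ νN φ φ′ z : Prop`.
HONEST LABEL: HC_CM is proved only modulo the 7 printed citations (2 remaining named inputs: hLiu418 = `stmt-HodgeConjecture-24832`, h413 = `stmt-HodgeConjecture-24833`) until rung 0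
closes; definitions only, count-neutral, closes no socket.

## References
* [MoeglinWaldspurger1995] C. Mœglin, J.-L. Waldspurger, *Spectral decomposition and Eisenstein series* (1995), I.2.17 (induced spaces, sections), II.1.5–II.1.7 (Eisenstein series, constant terms, `M(w, π)`).
* [GelbartRogawski1991] S. Gelbart, J. Rogawski, *L-functions and Fourier–Jacobi coefficients for the unitary group U(3)*, Invent. Math. 105 (1991), §3.1 (induced representations of `U(1,1)`).
* [Tan1999] V. Tan, *Poles of Siegel Eisenstein series on U(n,n)*, Canad. J. Math. 51 (1999), §1 (sections `f ∈ I(s, χ)`).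
-/

set_option autoImplicit false
-- the mandated namespace repeats the single-problem summit's segment (`HodgeConjecture.HodgeConjecture`)
set_option linter.dupNamespace false

noncomputable section

open NumberField IsDedekindDomain MeasureTheory Matrix
open scoped NNReal MatrixGroups
open Literature.NumberTheory.Automorphic Literature.NumberTheory.Automorphic.UnitaryGroup AdelicGroupData
open Literature.NumberTheory.GaloisRepresentations (HeckeCharacter ideleGroup principalIdeles)
open Summit.HodgeConjecture.HodgeConjecture.Cruxes.H413.K2E1BorelEisensteinU

namespace Summit.HodgeConjecture.HodgeConjecture.Cruxes.H413.K2E1CharacterEisensteinU2Defs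

variable {F E : Type} [Field F] [NumberField F] [Field E] [NumberField E] [Algebra F E] {c : E ≃ₐ[F] E} {N : ℕ} [NeZero N]

/-! ## §1 The first diagonal entry `b₀₀` of `b ∈ B(𝔸_F)` as an idele -/

/-- For `b′ ∈ B(𝔸_F)` (upper triangular) the `(0,0)` entry is multiplicative: `(g b′)₀₀ = g₀₀ · b′₀₀`. [cite: Rogawski1990, §1.10 p. 9] -/
theorem apply_zero_zero_mul_of_mem_borelAdelic (g : (quasiSplit F E c N).Adelic) {b' : (quasiSplit F E c N).Adelic} (hb' : b' ∈ borelAdelic F E c N) :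
    (adelicVal F E c N _ (g * b') : Matrix (Fin N) (Fin N) (AdeleRing (𝓞 E) E)) 0 0 =
      (adelicVal F E c N _ g : Matrix (Fin N) (Fin N) (AdeleRing (𝓞 E) E)) 0 0 * (adelicVal F E c N _ b' : Matrix (Fin N) (Fin N) (AdeleRing (𝓞 E) E)) 0 0 := by
  rw [map_mul, Units.val_mul, Matrix.mul_apply, Finset.sum_eq_single (0 : Fin N)]
  · intro j _ hj
    rw [(mem_borelAdelic_iff b').1 hb' (show ((id : Fin N → Fin N) 0) < id j from lt_of_le_of_ne (Fin.zero_le _) (Ne.symm hj)), mul_zero]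
  · exact fun h => (h (Finset.mem_univ _)).elim

/-- **The first diagonal entry `b₀₀` of `b ∈ B(𝔸_F)` as an idele of `E`** (its inverse is `(b⁻¹)₀₀`; the twin of ★ `lastEntryUnit = b_{N−1,N−1}`).  For `U(1,1)`, `b = (a *; 0 ā⁻¹)` and this is
`a`, the coordinate of the Levi `T(𝔸) ≅ 𝔸_Lˣ` through which the cuspidal datum `χ` is read. [cite: GelbartRogawski1991, §3.1] [cite: Rogawski1990, §1.10 p. 9] -/
def firstEntryUnit {b : (quasiSplit F E c N).Adelic} (hb : b ∈ borelAdelic F E c N) : (AdeleRing (𝓞 E) E)ˣ where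
  val := (adelicVal F E c N _ b : Matrix (Fin N) (Fin N) (AdeleRing (𝓞 E) E)) 0 0
  inv := (adelicVal F E c N _ b⁻¹ : Matrix (Fin N) (Fin N) (AdeleRing (𝓞 E) E)) 0 0
  val_inv := by
    rw [← apply_zero_zero_mul_of_mem_borelAdelic b (Subgroup.inv_mem _ hb), mul_inv_cancel, map_one, Units.val_one, Matrix.one_apply_eq]
  inv_val := by
    rw [← apply_zero_zero_mul_of_mem_borelAdelic b⁻¹ hb, inv_mul_cancel, map_one, Units.val_one, Matrix.one_apply_eq]

/-- `firstEntryUnit hb = b₀₀` (definitional). [cite: Rogawski1990, §1.10 p. 9] -/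
@[simp] theorem coe_firstEntryUnit {b : (quasiSplit F E c N).Adelic} (hb : b ∈ borelAdelic F E c N) :
    (firstEntryUnit hb : AdeleRing (𝓞 E) E) = (adelicVal F E c N _ b : Matrix (Fin N) (Fin N) (AdeleRing (𝓞 E) E)) 0 0 := rfl

/-- `b ↦ b₀₀` is multiplicative on `B(𝔸_F)`. [cite: Rogawski1990, §1.10 p. 9] -/
theorem firstEntryUnit_mul {b b' : (quasiSplit F E c N).Adelic} (hb : b ∈ borelAdelic F E c N) (hb' : b' ∈ borelAdelic F E c N) :
    firstEntryUnit (Subgroup.mul_mem _ hb hb') = firstEntryUnit hb * firstEntryUnit hb' :=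
  Units.ext (apply_zero_zero_mul_of_mem_borelAdelic b hb')

/-- `1₀₀ = 1`. [folklore] -/
@[simp] theorem firstEntryUnit_one : firstEntryUnit (Subgroup.one_mem (borelAdelic F E c N)) = 1 :=
  Units.ext (by rw [coe_firstEntryUnit, map_one, Units.val_one, Matrix.one_apply_eq, Units.val_one])

/-- For `u ∈ N(𝔸_F)` (upper unitriangular), `u₀₀ = 1`. [cite: Rogawski1990, §1.10 p. 9] -/
theorem firstEntryUnit_eq_one_of_mem_adelicUnipotent {u : (quasiSplit F E c N).Adelic} (hu : u ∈ adelicUnipotent F E c N) :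
    firstEntryUnit (adelicUnipotent_le_borelAdelic hu) = 1 :=
  Units.ext (by rw [coe_firstEntryUnit, Units.val_one]; exact ((mem_upperUnitriangular_iff _).1 ((mem_adelicUnipotent_iff u).1 hu)).2 0)

/-- **For a RATIONAL Borel element `γ ∈ B(F)` the idele `γ₀₀` is principal** (the diagonal image of the non-zero element `γ₀₀ ∈ E`). [cite: Rogawski1990, §1.9 p. 9] -/
theorem firstEntryUnit_toAdelic_mem_principalIdeles (γ : (quasiSplit F E c N).Rational) (hγ : (quasiSplit F E c N).toAdelic γ ∈ borelAdelic F E c N) :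
    firstEntryUnit hγ ∈ principalIdeles E := by
  have hinj := AdeleRing.algebraMap_injective (𝓞 E) E
  -- the rational matrix of `γ` and of `γ⁻¹`
  have hval : (firstEntryUnit hγ : AdeleRing (𝓞 E) E) =
      algebraMap E (AdeleRing (𝓞 E) E) ((((show ↥(rational F E c N ((StdForm.antidiagonal N).over E)) from γ) : GL (Fin N) E) : Matrix (Fin N) (Fin N) E) 0 0) := rfl
  have hinv : ((firstEntryUnit hγ)⁻¹ : (AdeleRing (𝓞 E) E)ˣ).val =
      algebraMap E (AdeleRing (𝓞 E) E) ((((show ↥(rational F E c N ((StdForm.antidiagonal N).over E)) from γ⁻¹) : GL (Fin N) E) : Matrix (Fin N) (Fin N) E) 0 0) := by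
    show (adelicVal F E c N _ ((quasiSplit F E c N).toAdelic γ)⁻¹ : Matrix (Fin N) (Fin N) (AdeleRing (𝓞 E) E)) 0 0 = _
    rw [← map_inv]
    rfl
  refine ⟨⟨((((show ↥(rational F E c N ((StdForm.antidiagonal N).over E)) from γ) : GL (Fin N) E) : Matrix (Fin N) (Fin N) E) 0 0),
    ((((show ↥(rational F E c N ((StdForm.antidiagonal N).over E)) from γ⁻¹) : GL (Fin N) E) : Matrix (Fin N) (Fin N) E) 0 0),
    hinj (by rw [map_mul, map_one, ← hval, ← hinv]; exact Units.mul_inv _), hinj (by rw [map_mul, map_one, ← hval, ← hinv]; exact Units.inv_mul _)⟩, Units.ext hval.symm⟩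

/-! ## §2 `χ`-sections -/

/-- **`χ`-SECTIONS**: `φ : G(𝔸_F) → ℂ` with `φ(b g) = χ(b₀₀)·φ(g)` for every `b ∈ B(𝔸_F)` — the exponent-`0` slice of the induced space `I(χ)` from the Borel in the tree's RAW normalisation
(the flat section ★ `flatSectionU φ z = φ·H^z` then carries `χ‖·‖^z`; for `U(1,1)` this is K2Liu's `I(s, χ)` at `z = s + ½`).  Right `K`-type ∕ `K`-finiteness data are untouched.
[cite: MoeglinWaldspurger1995, I.2.17] [cite: Tan1999, §1] -/
def IsChiSection (χ : HeckeCharacter E) (φ : (quasiSplit F E c N).Adelic → ℂ) : Prop :=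
  ∀ (b : (quasiSplit F E c N).Adelic) (hb : b ∈ borelAdelic F E c N) (g : (quasiSplit F E c N).Adelic), φ (b * g) = ((χ (firstEntryUnit hb) : ℂˣ) : ℂ) * φ g

namespace IsChiSection

variable {χ : HeckeCharacter E} {φ ψ : (quasiSplit F E c N).Adelic → ℂ}

/-- The defining equivariance. [cite: MoeglinWaldspurger1995, I.2.17] -/
theorem borel_mul (hφ : IsChiSection χ φ) {b : (quasiSplit F E c N).Adelic} (hb : b ∈ borelAdelic F E c N) (g : (quasiSplit F E c N).Adelic) :
    φ (b * g) = ((χ (firstEntryUnit hb) : ℂˣ) : ℂ) * φ g := hφ b hb g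

/-- **`χ`-sections are left-`N(𝔸_F)`-invariant** (`u₀₀ = 1`). [cite: MoeglinWaldspurger1995, I.2.17] -/
theorem unipotent_mul (hφ : IsChiSection χ φ) (u : ↥(adelicUnipotent F E c N)) (g : (quasiSplit F E c N).Adelic) :
    φ ((u : (quasiSplit F E c N).Adelic) * g) = φ g := by
  rw [hφ.borel_mul (adelicUnipotent_le_borelAdelic u.2), firstEntryUnit_eq_one_of_mem_adelicUnipotent u.2, map_one, Units.val_one, one_mul]

/-- **`χ`-sections are left-`B(F)`-invariant** (`χ` is trivial on principal ideles, ★ `HeckeCharacter.map_principal`) — the hypothesis `hφ` of ★ `flatSectionU_toAdelic_mul` ∕ `eisensteinSeriesU_*`.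
[cite: MoeglinWaldspurger1995, II.1.5] -/
theorem toAdelic_mul (hφ : IsChiSection χ φ) :
    ∀ b ∈ borelU (c : E →+* E) ((StdForm.antidiagonal N).over E), ∀ x : (quasiSplit F E c N).Adelic, φ ((quasiSplit F E c N).toAdelic b * x) = φ x := fun b hb x => by
  rw [hφ.borel_mul (toAdelic_mem_borelAdelic_of_mem_borelU hb), HeckeCharacter.map_principal χ (firstEntryUnit_toAdelic_mem_principalIdeles b _), Units.val_one, one_mul]

/-- `0` is a `χ`-section. [folklore] -/
theorem zero (χ : HeckeCharacter E) : IsChiSection (F := F) (c := c) (N := N) χ 0 := fun _ _ _ => by simp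

/-- Sums of `χ`-sections. [folklore] -/
theorem add (hφ : IsChiSection χ φ) (hψ : IsChiSection χ ψ) : IsChiSection χ (φ + ψ) := fun b hb g => by
  simp only [Pi.add_apply, hφ b hb g, hψ b hb g, mul_add]

/-- Scalar multiples of `χ`-sections. [folklore] -/
theorem smul (hφ : IsChiSection χ φ) (a : ℂ) : IsChiSection χ (a • φ) := fun b hb g => by
  simp only [Pi.smul_apply, smul_eq_mul, hφ b hb g]; ring

/-- **A `χ`-section times a left-`B(𝔸_F)`-invariant function is a `χ`-section** (how the right `K`-type factors of ★ (D5-b′) and finite-level data are attached). [cite: MoeglinWaldspurger1995, I.2.17] -/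
theorem mul_of_invariant (hφ : IsChiSection χ φ) (hψ : ∀ (b : (quasiSplit F E c N).Adelic), b ∈ borelAdelic F E c N → ∀ g : (quasiSplit F E c N).Adelic, ψ (b * g) = ψ g) :
    IsChiSection χ (φ * ψ) := fun b hb g => by
  simp only [Pi.mul_apply, hφ b hb g, hψ b hb g, mul_assoc]

end IsChiSection

/-- For the trivial character, left-`B(𝔸_F)`-invariant functions are `1`-sections (the spherical currency is the `χ = 1` case). [cite: MoeglinWaldspurger1995, I.2.17] -/
theorem isChiSection_one_of_borel_invariant {φ : (quasiSplit F E c N).Adelic → ℂ}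
    (hφ : ∀ (b : (quasiSplit F E c N).Adelic), b ∈ borelAdelic F E c N → ∀ g : (quasiSplit F E c N).Adelic, φ (b * g) = φ g) : IsChiSection (1 : HeckeCharacter E) φ :=
  fun b hb g => by rw [hφ b hb g]; simp

/-- **For a UNITARY `χ` the absolute value of a `χ`-section is left-`B(𝔸_F)`-invariant** — so the Godement majorant of `flatSectionU φ z` is the spherical one (★ `norm_flatSectionU`, unchanged).
[cite: MoeglinWaldspurger1995, II.1.5] -/
theorem norm_apply_borel_mul_of_isUnitary {χ : HeckeCharacter E} (hχ : χ.IsUnitary) {φ : (quasiSplit F E c N).Adelic → ℂ} (hφ : IsChiSection χ φ)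
    {b : (quasiSplit F E c N).Adelic} (hb : b ∈ borelAdelic F E c N) (g : (quasiSplit F E c N).Adelic) : ‖φ (b * g)‖ = ‖φ g‖ := by
  rw [hφ.borel_mul hb, norm_mul, hχ, one_mul]

/-- **The flat section of a `χ`-section transforms by `χ‖·‖^z`**: `f_z(b g) = χ(b₀₀) · (‖b_{N−1,N−1}‖_𝔸⁻¹)^z · f_z(g)` (★ `borelHeight_borel_mul`; for `U(1,1)`, `‖b₁₁‖⁻¹ = ‖ā⁻¹‖⁻¹ = ‖a‖`).
[cite: MoeglinWaldspurger1995, I.2.17, II.1.5] -/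
theorem flatSectionU_borel_mul_of_isChiSection {χ : HeckeCharacter E} {φ : (quasiSplit F E c N).Adelic → ℂ} (hφ : IsChiSection χ φ) (z : ℂ)
    {b : (quasiSplit F E c N).Adelic} (hb : b ∈ borelAdelic F E c N) (g : (quasiSplit F E c N).Adelic) :
    flatSectionU φ z (b * g) =
      ((χ (firstEntryUnit hb) : ℂˣ) : ℂ) * ((((IdeleClassGroup.ideleNorm E (lastEntryUnit hb))⁻¹ : ℝ≥0) : ℝ) : ℂ) ^ z * flatSectionU φ z g := by
  rw [flatSectionU_apply, flatSectionU_apply, hφ.borel_mul hb, borelHeight_borel_mul hb, NNReal.coe_mul, Complex.ofReal_mul,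
    Complex.mul_cpow_ofReal_nonneg (NNReal.coe_nonneg _) (NNReal.coe_nonneg _)]
  ring

/-- **Flat sections of `χ`-sections are left-`B(F)`-invariant** (★ `flatSectionU_toAdelic_mul` with `IsChiSection.toAdelic_mul`) — so ★ `eisensteinSeriesU_rational_mul`, ★
`eisensteinSeriesU_eq_apply_add_tsum_unipotent_two ∕ _three` and ★ `borelConstantTerm_eisensteinSeriesU_two ∕ _three` apply to `eisensteinSeriesU (flatSectionU φ z)` VERBATIM. [cite: MoeglinWaldspurger1995, II.1.5] -/
theorem flatSectionU_toAdelic_mul_of_isChiSection {χ : HeckeCharacter E} {φ : (quasiSplit F E c N).Adelic → ℂ} (hφ : IsChiSection χ φ) (z : ℂ) :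
    ∀ b ∈ borelU (c : E →+* E) ((StdForm.antidiagonal N).over E), ∀ x : (quasiSplit F E c N).Adelic,
      flatSectionU φ z ((quasiSplit F E c N).toAdelic b * x) = flatSectionU φ z x :=
  flatSectionU_toAdelic_mul hφ.toAdelic_mul z

/-! ## §3 The reflected character `χʷ(a) = χ(c a)⁻¹` -/

omit [NumberField F] in
/-- `c ⊗ 1` on the ideles `𝕀_E` (`Units.map` of ★ `conjAdele`) is continuous. [cite: GelbartRogawski1991, §3.1] -/
theorem continuous_units_map_conjAdele : Continuous (Units.map (conjAdele F E c : AdeleRing (𝓞 E) E →+* AdeleRing (𝓞 E) E).toMonoidHom) :=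
  Continuous.units_map _ (continuous_conjAdele F E c)

omit [NumberField F] in
/-- `c ⊗ 1` maps principal ideles to principal ideles (`(c ⊗ 1)(x) = c(x)` for `x ∈ E`, ★ `algebraMap_conj`). [cite: GelbartRogawski1991, §3.1] -/
theorem units_map_conjAdele_mem_principalIdeles {x : ideleGroup E} (hx : x ∈ principalIdeles E) :
    Units.map (conjAdele F E c : AdeleRing (𝓞 E) E →+* AdeleRing (𝓞 E) E).toMonoidHom x ∈ principalIdeles E := by
  obtain ⟨u, rfl⟩ := hx
  refine ⟨Units.map (c : E ≃ₐ[F] E).toRingEquiv.toRingHom.toMonoidHom u, Units.ext ?_⟩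
  show algebraMap E (AdeleRing (𝓞 E) E) ((c : E →+* E) (u : E)) = conjAdele F E c (algebraMap E (AdeleRing (𝓞 E) E) (u : E))
  exact algebraMap_conj F E c (u : E)

/-- **THE REFLECTED CHARACTER `χʷ := (χ ∘ (c ⊗ 1))⁻¹`**, `χʷ(a) = χ(c a)⁻¹`: the character of `T(𝔸) ≅ 𝔸_Lˣ` obtained from `χ` by conjugating with the long Weyl element
(`w·diag(a, ā⁻¹)·w⁻¹ = diag(ā⁻¹, a)`); the constant term of `E(χ, ·)` has its second summand in `I(χʷ)`.  In general `χʷ ≠ χ` (the spherical case had `χ = χʷ = 1`); for unitary `χ`,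
`χʷ = \\overline{χ} ∘ c`. [cite: MoeglinWaldspurger1995, II.1.7] [cite: GelbartRogawski1991, §3.1] -/
def reflectChar (c : E ≃ₐ[F] E) (χ : HeckeCharacter E) : HeckeCharacter E where
  toContinuousMonoidHom :=
    ⟨((χ : ideleGroup E →* ℂˣ).comp (Units.map (conjAdele F E c : AdeleRing (𝓞 E) E →+* AdeleRing (𝓞 E) E).toMonoidHom))⁻¹,
      ((map_continuous χ).comp continuous_units_map_conjAdele).inv⟩
  map_principal' x hx := by
    show ((χ : ideleGroup E →* ℂˣ) (Units.map (conjAdele F E c : AdeleRing (𝓞 E) E →+* AdeleRing (𝓞 E) E).toMonoidHom x))⁻¹ = 1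
    rw [inv_eq_one]
    exact HeckeCharacter.map_principal χ (units_map_conjAdele_mem_principalIdeles hx)

omit [NumberField F] in
/-- `χʷ(a) = χ((c ⊗ 1) a)⁻¹`. [cite: MoeglinWaldspurger1995, II.1.7] -/
theorem reflectChar_apply (χ : HeckeCharacter E) (a : ideleGroup E) :
    reflectChar c χ a = (χ (Units.map (conjAdele F E c : AdeleRing (𝓞 E) E →+* AdeleRing (𝓞 E) E).toMonoidHom a))⁻¹ := rfl

omit [NumberField F] in
/-- On adeles: `((c ⊗ 1) a : 𝔸_E) = c • a`. [folklore] -/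
theorem coe_units_map_conjAdele (a : ideleGroup E) :
    ((Units.map (conjAdele F E c : AdeleRing (𝓞 E) E →+* AdeleRing (𝓞 E) E).toMonoidHom a : ideleGroup E) : AdeleRing (𝓞 E) E) = c • (a : AdeleRing (𝓞 E) E) := rfl

omit [NumberField F] in
/-- **`(χʷ)ʷ = χ`** when `c` is an involution. [cite: MoeglinWaldspurger1995, II.1.7] -/
theorem reflectChar_reflectChar (hc : c * c = 1) (χ : HeckeCharacter E) : reflectChar c (reflectChar c χ) = χ := by
  refine DFunLike.ext _ _ fun a => ?_
  rw [reflectChar_apply, reflectChar_apply, inv_inv]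
  congr 1
  refine Units.ext ?_
  rw [coe_units_map_conjAdele, coe_units_map_conjAdele, smul_smul, hc, one_smul]

omit [NumberField F] in
/-- The reflected character of a unitary character is unitary. [cite: MoeglinWaldspurger1995, II.1.7] -/
theorem IsUnitary.reflectChar {χ : HeckeCharacter E} (hχ : χ.IsUnitary) : (reflectChar c χ).IsUnitary := fun a => by
  rw [reflectChar_apply, Units.val_inv_eq_inv_val, norm_inv, hχ, inv_one]

/-! ## §4 (`N = 2`) The statement-only shape of the intertwined constant term -/

/-- **«`M(z, χ)φ = φ′`» — THE SHAPE OF THE INTERTWINING INTEGRAL, statement only (`N = 2`)**: `φ′` is a `χʷ`-section and the big-cell integral of the flat section `f_z = φH^z` over `N(𝔸_F)`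
(the second summand of the ★ Bruhat unfolding `borelConstantTerm_eisensteinSeriesU_two`, before the normalising factor `(ν𝓕)⁻¹`) IS the reflected flat section `f′_{1−z} = φ′H^{1−z}`:
`∫_{N(𝔸)} f_z(w v g) dν(v) = f′_{1−z}(g)` for all `g`.  With ★ unfolding this says `E_B(f_z) = f_z + (ν𝓕)⁻¹ • f′_{1−z}` — the target of the (χ,τ) FILE A2 (there `φ′ = M(z,χ)φ` is produced on
the half-plane of convergence and continued); an OPERATOR statement on the section space, not a scalar `c(z)` (multiplicity one fails at deep finite level).  Nothing about it is proved here.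
[cite: MoeglinWaldspurger1995, II.1.7] [cite: GelbartRogawski1991, §3.1] -/
def HasReflectedIntertwining [MeasurableSpace (quasiSplit F E c 2).Adelic] (χ : HeckeCharacter E) (νN : Measure ↥(adelicUnipotent F E c 2))
    (φ φ' : (quasiSplit F E c 2).Adelic → ℂ) (z : ℂ) : Prop :=
  IsChiSection (reflectChar c χ) φ' ∧
    ∀ g : (quasiSplit F E c 2).Adelic,
      ∫ v : ↥(adelicUnipotent F E c 2), flatSectionU φ z ((quasiSplit F E c 2).toAdelic (weylLongU (c : E →+* E) (rfl : (StdForm.antidiagonal 2).over E = (StdForm.antidiagonal 2).over E)) *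
        (v : (quasiSplit F E c 2).Adelic) * g) ∂νN = flatSectionU φ' (1 - z) g

/-- Unfolding `HasReflectedIntertwining`: the reflected section. [cite: MoeglinWaldspurger1995, II.1.7] -/
theorem HasReflectedIntertwining.isChiSection [MeasurableSpace (quasiSplit F E c 2).Adelic] {χ : HeckeCharacter E} {νN : Measure ↥(adelicUnipotent F E c 2)}
    {φ φ' : (quasiSplit F E c 2).Adelic → ℂ} {z : ℂ} (h : HasReflectedIntertwining χ νN φ φ' z) : IsChiSection (reflectChar c χ) φ' := h.1

/-- Unfolding `HasReflectedIntertwining`: the big-cell integral. [cite: MoeglinWaldspurger1995, II.1.7] -/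
theorem HasReflectedIntertwining.integral_eq [MeasurableSpace (quasiSplit F E c 2).Adelic] {χ : HeckeCharacter E} {νN : Measure ↥(adelicUnipotent F E c 2)}
    {φ φ' : (quasiSplit F E c 2).Adelic → ℂ} {z : ℂ} (h : HasReflectedIntertwining χ νN φ φ' z) (g : (quasiSplit F E c 2).Adelic) :
    ∫ v : ↥(adelicUnipotent F E c 2), flatSectionU φ z ((quasiSplit F E c 2).toAdelic (weylLongU (c : E →+* E) (rfl : (StdForm.antidiagonal 2).over E = (StdForm.antidiagonal 2).over E)) *
        (v : (quasiSplit F E c 2).Adelic) * g) ∂νN = flatSectionU φ' (1 - z) g := h.2 g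

end Summit.HodgeConjecture.HodgeConjecture.Cruxes.H413.K2E1CharacterEisensteinU2Defs
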